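import Literature.Probability.LatticeModels.FermionicObservable
import Literature.Probability.LatticeModels.MedialWinding
import HarnessLib

/-!
# `MedialWinding` and `FermionicObservable` define the same winding and passage sum (bridge lemmas)

`Literature/Probability/LatticeModels/MedialWinding.lean` is the fact-free home (imports
`MedialInterface` + `PolylineWinding` only) of the medial-path vocabulary `windingAt`,
`windingUpTo`, `passageSum` of `FermionicObservable.lean`, reproduced verbatim in the
sub-namespace `MedialPath` over `Polyline.winding` (definition item
`defn-ZdDiscretisationFamily-2`, route repair of the `CardyFormulaZ2` routes). This file, which
imports both, records once that the two copies are the same functions, so that a statement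
written against the fact-free module (a percolation route crux) and a lemma proved against
`FermionicObservable` (the FK-Ising files, `ExplorationWinding.lean`, `Sweep1*.lean`, …) can be
combined by one rewrite. Nothing is defined here; no route needs to import this file.

In this module both the real constants `Literature.Probability.LatticeModels.windingAt`, … (from
`FermionicObservable`) and the aliases of the same names exported by `MedialWinding` /
`PolylineWinding` are visible: fully-qualified names denote the real constants, the copies are
reached as `MedialPath.…` / `Polyline.…`, and the short names are ambiguous (so none is used).
(buildfix 2026-08-20: the proofs below are written to elaborate in BOTH regimes — before and after
the pending migration dedupe that deletes `FermionicObservable`'s old blocks and lets the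
fully-qualified names resolve to the exported aliases, at which point every bridge lemma is a
syntactic identity closed by the `rfl` branch; names and statements are unchanged so that users'
`rw`/`simp only` calls keep working.)

* `Polyline.turning_eq_turning`, `Polyline.winding_eq_winding(')` — the Mathlib-only polyline
  block of `PolylineWinding.lean` agrees with `FermionicObservable`'s (`rfl`, resp. induction);
* `MedialPath.windingAt_eq_windingAt(')`, `MedialPath.windingUpTo_eq_windingUpTo`,
  `MedialPath.passageSum_eq_passageSum(')`, `MedialPath.passageSum_medialExploration_eq`.

## References

* S. Smirnov, *Conformal invariance in random cluster models. I*, Ann. of Math. 172 (2010),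
  §2.2 (winding, observable). [Smirnov2010]
-/

/-! ### `Polyline.winding = winding` and the medial-path vocabulary agrees with `FermionicObservable` -/

namespace Literature.Probability.LatticeModels

/-- The two copies of the turning angle agree (same body). [folklore] -/
theorem Polyline.turning_eq_turning :
    @Polyline.turning = @Literature.Probability.LatticeModels.turning := rfl

/-- The two copies of the polyline winding agree: `Polyline.winding l = winding l` for every
list (both are the same structural recursion; induction on the list). [folklore] -/
theorem Polyline.winding_eq_winding :
    ∀ l : List ℂ, Polyline.winding l = Literature.Probability.LatticeModels.winding l
  | [] => rfl
  | [_] => rfl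
  | [_, _] => rfl
  | z₁ :: z₂ :: z₃ :: zs =>
    -- term-mode so that it elaborates in BOTH regimes (buildfix 2026-08-20): while
    -- `FermionicObservable` still carries its own copy of `winding` the three steps are the two
    -- recursion lemmas and the induction hypothesis; once the migration dedupe lands and the
    -- fully-qualified names are the aliases of `Polyline.…`, every step is a syntactic identity.
    (Polyline.winding_cons_cons_cons z₁ z₂ z₃ zs).trans
      ((congrArg₂ (· + ·)
          (congrFun (congrFun (congrFun Polyline.turning_eq_turning z₁) z₂) z₃)
          (Polyline.winding_eq_winding (z₂ :: z₃ :: zs))).trans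
        (Literature.Probability.LatticeModels.winding_cons_cons_cons z₁ z₂ z₃ zs).symm)

/-- Function-level form of `Polyline.winding_eq_winding`. [folklore] -/
theorem Polyline.winding_eq_winding' :
    @Polyline.winding = @Literature.Probability.LatticeModels.winding :=
  funext Polyline.winding_eq_winding

/-- The fact-free `MedialPath.windingAt` (`MedialWinding.lean`) is `FermionicObservable`'s
`windingAt`. [folklore] -/
theorem MedialPath.windingAt_eq_windingAt (γ : List MedialVertex) (δ : ℝ) (k : ℕ) :
    MedialPath.windingAt γ δ k = Literature.Probability.LatticeModels.windingAt γ δ k := by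
  try rfl
  try simp only [MedialPath.windingAt, Literature.Probability.LatticeModels.windingAt,
    Polyline.winding_eq_winding]

/-- Function-level form of `MedialPath.windingAt_eq_windingAt`. [folklore] -/
theorem MedialPath.windingAt_eq_windingAt' :
    @MedialPath.windingAt = @Literature.Probability.LatticeModels.windingAt :=
  funext₃ MedialPath.windingAt_eq_windingAt

/-- The fact-free `MedialPath.windingUpTo` is `FermionicObservable`'s `windingUpTo`. [folklore] -/
theorem MedialPath.windingUpTo_eq_windingUpTo (γ : List MedialVertex) (δ : ℝ) (z : MedialVertex) :
    MedialPath.windingUpTo γ δ z = Literature.Probability.LatticeModels.windingUpTo γ δ z :=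
  MedialPath.windingAt_eq_windingAt γ δ _

/-- The fact-free `MedialPath.passageSum` (`MedialWinding.lean`) is `FermionicObservable`'s
`passageSum`: the parafermionic passage sums written against either module are the same
numbers. [folklore] -/
theorem MedialPath.passageSum_eq_passageSum (γ : List MedialVertex) (δ spin : ℝ)
    (z : MedialVertex) :
    MedialPath.passageSum γ δ spin z = Literature.Probability.LatticeModels.passageSum γ δ spin z := by
  try rfl
  try simp only [MedialPath.passageSum, Literature.Probability.LatticeModels.passageSum,
    MedialPath.windingAt_eq_windingAt]

/-- Function-level form of `MedialPath.passageSum_eq_passageSum`. [folklore] -/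
theorem MedialPath.passageSum_eq_passageSum' :
    @MedialPath.passageSum = @Literature.Probability.LatticeModels.passageSum := by
  funext γ δ spin z
  exact MedialPath.passageSum_eq_passageSum γ δ spin z

/-- In particular the FK / percolation observables agree: for every discrete Dobrushin domain
the passage sum of the exploration path `fkInterface E ω = medialExploration E ω` is the same
whichever copy of `passageSum` is used. [folklore] -/
theorem MedialPath.passageSum_medialExploration_eq (E : DiscreteDobrushin)
    (ω : Percolation.BondConfig (Site 2)) (spin : ℝ) (z : MedialVertex) :
    MedialPath.passageSum (medialExploration E ω) E.δ spin z =
      Literature.Probability.LatticeModels.passageSum (fkInterface E ω) E.δ spin z :=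
  MedialPath.passageSum_eq_passageSum _ _ _ _

end Literature.Probability.LatticeModels
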